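/-
Copyright (c) 2026 the pub-hodgecm-mathlib formalisation cell (harness21).  Prover seat hodgecm-mathlib-LH4-p15 (g0), req620 Track A «(D-RAM) FOUR-FRAME» squad
(STAGE-1b, row (2) of the piece `f_{T₊}`, the (β₂) road (R-36) «PURE-CELL LEDGER»: β₂ sub-dealer LH4-p04 (g8) β₂-BOARD v1∕v1.1 row (L-P) «axis cells = ★ p861154's half
(LH4-p15) as instances»; LH4-p09 (g9) 14:47:36Z recipe (3) «ε = multiplication by a torus unit, `⟨εx, εy⟩ = (εΘε)·⟨x, y⟩` (★ (C1) `hform`, one `ring`)»), 2026-09-04.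
-/
import Summits.HodgeConjecture.HodgeConjecture.Theorems.F0P3cDyRamConeCellFaceAxis   -- ★ p861154 (this seat): the `vs`-dictionary heads; brings ★ census DEFS, ★ `pairing`, ★ DEFS `levelSet`
import HarnessLib

/-!
# Crux `H413`, line LH4 «(D-RAM) FOUR-FRAME» — STAGE-1b, row (2), the (β₂) road (R-36): «THE LINE-MODEL UNIT AS A PLANE SIMILITUDE» — multiplication by `z ∈ M` on the line
# model `φ : E² ≅ M` IS a matrix `ε` of the plane with `φ(εx) = z·φ(x)`, a SIMILITUDE of multiplier `ξ` when `z·Θz = jE ξ` (★ (C1) `hform`), COMMUTING with `γ₂` (`φγ₂ = lam·φ`), and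
# `φ(ε·B) = z • φ(B)` — the instance data that ★ p861069 ∕ ★ p861311 (`hε`, `hεγ`, `(ε·B₂, ε·w₀)`) and ★ p861154 §4 (`vs (z • Λ) = (ξ·) '' vs Λ`) ask for

Cell `hodgecm-mathlib` (D-0151), FLOOR 0, crux item H413 = `stmt-HodgeConjecture-24833`, route of record `HCCMUnconditional`; squad F0∕P3c∕LH4; lane
`--supports stmt-HodgeConjecture-24833 --as helper` (count-neutral; pays NO tier-0 row).  THEOREMS ONLY (no `def`, no instance, no notation, no `sorry`, default heartbeats);
★-only imports; states NO law.  DATUM-FREE: fields `E`, `M`, ring maps `σ, jE, ρ, Θ`, the line model `φ` of ★ `EllipticPlaneAsFieldLineDictionary` (`hφs hφi hφo hφγ hform`).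

WHY.  Every symmetry the (β₂) rows use on a cone cell of the LINE MODEL is `Λ ↦ z • Λ` (`z ∈ M`, `z·Θz = jE ξ`: ★ p860839 cell preservation, ★ `exists_flipUnit…` existence, ★
p861460 populated ⇒ norm), while the LETTER lives on the PLANE (★ p861069 ∕ ★ p861311: a `γ₂`-commuting similitude `ε` of multiplier `ξ` multiplies the depth-form letter by `ξ`).  The
bridge between the two is elementary and was not on disk:
* §1 `exists_matrix_mulVec_eq_mul` — for every `z : M` there is `ε : Matrix (Fin 2) (Fin 2) E` with `φ (ε *ᵥ x) = z·φ x` (the `E`-linear map `x ↦ φ⁻¹(z·φx)`, `hφs hφi hφo`).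
* §2 `pairing_mulVec_mulVec_eq_mul_of_lineModel` — if `z·Θz = jE ξ` then `⟨εx, εy⟩_{H₂} = ξ·⟨x, y⟩_{H₂}` (`hform`: `jE⟨εx, εy⟩ = (zΘz)·(h·Θφx·φy) + ρ(…) = jE ξ·jE⟨x, y⟩`,
  `ρ(jE ξ) = jE ξ` by `hjfix`).
* §3 `mulVec_comm_of_lineModel` ∕ `mul_eq_mul_of_lineModel` — `ε` commutes with `γ₂` (`φ(εγ₂x) = z·lam·φx = φ(γ₂εx)`, `hφi`).
* §4 `map_map_toLin'_eq_smul` — `(B.map ε).toAddSubgroup.map φ = z • (B.toAddSubgroup.map φ)`; `exists_similitude_of_lineModel` — the package (§1–§4 at once).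
So, for a presented `Λ = φ(B₂)` with `φ w₀ = Y⁻¹x₀`, the vertex over `z • Λ` is the glued vertex over `(ε·B₂, ε·w₀)` and ★ p861311∕★ p861368 apply with `hε, hεγ` discharged here.
HONEST LABEL.  Count-neutral linear algebra; nothing printed is asserted; no census law is stated; `HC_CM` is proved only modulo the 7 printed citations (2 remaining named inputs:
hLiu418 = `stmt-HodgeConjecture-24832`, h413 = `stmt-HodgeConjecture-24833`) until rung 0 closes.
## References
* [Flicker1998UnitaryFL] Y. Z. Flicker, *Elementary proof of the fundamental lemma for a unitary group*, Canad. J. Math. 50 (1998), p. 84 REMARK (the elliptic plane as a line).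
* [Jacobowitz1962] R. Jacobowitz, *Hermitian forms over local fields*, Amer. J. Math. 84 (1962): §4 (similitudes of hermitian planes).
* [Kottwitz1986BaseChangeUnits] R. E. Kottwitz, *Base change for unit elements of Hecke algebras*, Compositio Math. 60 (1986): §1 pp. 240–241.
-/

set_option autoImplicit false

noncomputable section

namespace Summit.HodgeConjecture.HodgeConjecture.Cruxes.H413.F0P3cDyRamLineModelSimilitude

open scoped Valued WithZero Matrix MatrixGroups Pointwise
open Literature.NumberTheory.Automorphic Literature.NumberTheory.Automorphic.HermitianLattice Literature.NumberTheory.Automorphic.UnitaryLatticeTree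

variable {E : Type*} {M : Type*} [Field E] [Field M]

/-! ## §1 Multiplication by `z` on the line model is a matrix of the plane -/

/-- **MULTIPLICATION BY `z ∈ M` IS A MATRIX OF THE PLANE**: for the line model `φ : E² → M` (additive, `φ(c•x) = jE c·φx`, bijective) and any `z : M` there is
`ε : Matrix (Fin 2) (Fin 2) E` with `φ (ε *ᵥ x) = z·φ x` for all `x` — the matrix of the `E`-linear map `x ↦ φ⁻¹(z·φ x)`. [cite: Flicker1998UnitaryFL, p. 84 REMARK] -/
theorem exists_matrix_mulVec_eq_mul (jE : E →+* M) (φ : (Fin 2 → E) →+ M) (hφs : ∀ (c : E) (x : Fin 2 → E), φ (c • x) = jE c * φ x)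
    (hφi : Function.Injective φ) (hφo : Function.Surjective φ) (z : M) :
    ∃ ε : Matrix (Fin 2) (Fin 2) E, ∀ x : Fin 2 → E, φ (ε *ᵥ x) = z * φ x := by
  classical
  let Φ : (Fin 2 → E) ≃+ M := AddEquiv.ofBijective φ ⟨hφi, hφo⟩
  have key : ∀ w : M, φ (Φ.symm w) = w := fun w => Φ.apply_symm_apply w
  let L : (Fin 2 → E) →ₗ[E] (Fin 2 → E) :=
    { toFun := fun x => Φ.symm (z * φ x)
      map_add' := fun x y => by
        apply hφi
        simp only [key, map_add, mul_add]
      map_smul' := fun c x => by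
        apply hφi
        simp only [key, hφs, RingHom.id_apply]
        ring }
  refine ⟨LinearMap.toMatrix' L, fun x => ?_⟩
  rw [← Matrix.toLin'_apply, Matrix.toLin'_toMatrix']
  exact key (z * φ x)

/-! ## §2 It is a similitude of multiplier `ξ` when `z·Θz = jE ξ` -/

/-- **THE LINE-MODEL UNIT IS A SIMILITUDE OF THE PLANE**: with ★ (C1)'s value dictionary `jE⟨x, y⟩_{H₂} = h·Θ(φx)·φy + ρ(h·Θ(φx)·φy)`, `Fix ρ = jE(E)`, a matrix `ε` with `φ(εx) = z·φx`
and `z·Θz = jE ξ`: `⟨εx, εy⟩_{H₂} = ξ·⟨x, y⟩_{H₂}` for all `x, y` (the `hε` of ★ p861069 ∕ ★ p861311). [cite: Jacobowitz1962, §4] [cite: Flicker1998UnitaryFL, p. 84 REMARK] -/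
theorem pairing_mulVec_mulVec_eq_mul_of_lineModel (σ : E →+* E) (H₂ : Matrix (Fin 2) (Fin 2) E) (jE : E →+* M) {ρ Θ : M →+* M}
    (hjfix : ∀ w, ρ w = w ↔ ∃ c, jE c = w) (φ : (Fin 2 → E) →+ M) {h : M}
    (hform : ∀ x y, jE (pairing σ H₂ x y) = h * Θ (φ x) * φ y + ρ (h * Θ (φ x) * φ y))
    {ε : Matrix (Fin 2) (Fin 2) E} {z : M} (hε : ∀ x, φ (ε *ᵥ x) = z * φ x) {ξ : E} (hzξ : z * Θ z = jE ξ) (x y : Fin 2 → E) :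
    pairing σ H₂ (ε *ᵥ x) (ε *ᵥ y) = ξ * pairing σ H₂ x y := by
  have hρξ : ρ (jE ξ) = jE ξ := (hjfix _).2 ⟨ξ, rfl⟩
  apply jE.injective
  rw [hform, hε, hε, map_mul jE, hform, map_mul Θ]
  have e1 : h * (Θ z * Θ (φ x)) * (z * φ y) = jE ξ * (h * Θ (φ x) * φ y) := by rw [← hzξ]; ring
  rw [e1, map_mul ρ, hρξ]
  ring

/-! ## §3 It commutes with `γ₂` -/

/-- **THE LINE-MODEL UNIT COMMUTES WITH `γ₂`, vector form**: `ε *ᵥ (γ₂ *ᵥ x) = γ₂ *ᵥ (ε *ᵥ x)` (`φ(γ₂x) = lam·φx`, `φ` injective, `M` commutative).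
[cite: Flicker1998UnitaryFL, p. 84 REMARK] -/
theorem mulVec_comm_of_lineModel (φ : (Fin 2 → E) →+ M) (hφi : Function.Injective φ)
    {γ₂ : Matrix (Fin 2) (Fin 2) E} {lam : M} (hφγ : ∀ x, φ (γ₂ *ᵥ x) = lam * φ x)
    {ε : Matrix (Fin 2) (Fin 2) E} {z : M} (hε : ∀ x, φ (ε *ᵥ x) = z * φ x) (x : Fin 2 → E) :
    ε *ᵥ (γ₂ *ᵥ x) = γ₂ *ᵥ (ε *ᵥ x) := by
  apply hφi
  rw [hε, hφγ, hφγ, hε]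
  ring

/-- **THE LINE-MODEL UNIT COMMUTES WITH `γ₂`, matrix form**: `ε * γ₂ = γ₂ * ε` (the `hεγ` of ★ p861069 ∕ ★ p861311). [cite: Flicker1998UnitaryFL, p. 84 REMARK] -/
theorem mul_eq_mul_of_lineModel (φ : (Fin 2 → E) →+ M) (hφi : Function.Injective φ)
    {γ₂ : Matrix (Fin 2) (Fin 2) E} {lam : M} (hφγ : ∀ x, φ (γ₂ *ᵥ x) = lam * φ x)
    {ε : Matrix (Fin 2) (Fin 2) E} {z : M} (hε : ∀ x, φ (ε *ᵥ x) = z * φ x) :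
    ε * γ₂ = γ₂ * ε := by
  refine Matrix.toLin'.injective (LinearMap.ext fun x => ?_)
  rw [Matrix.toLin'_apply, Matrix.toLin'_apply, ← Matrix.mulVec_mulVec, ← Matrix.mulVec_mulVec]
  exact mulVec_comm_of_lineModel φ hφi hφγ hε x

/-! ## §4 Lattice transport: `φ(ε·B) = z • φ(B)` -/

/-- **`φ(ε·B) = z • φ(B)`**: the image under `φ` of the plane lattice `ε·B` (as `B.map (toLin' ε)`) is the pointwise multiple `z • φ(B)` of the order lattice `φ(B)` — so the cone
cell member `z • Λ` of the line model is presented by the plane data `ε·B₂` (and `ε·w₀`, next lemma). [cite: Flicker1998UnitaryFL, p. 84 REMARK] [cite: Kottwitz1986BaseChangeUnits, §1 pp. 240–241] -/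
theorem map_map_toLin'_eq_smul [Valued E ℤᵐ⁰] (φ : (Fin 2 → E) →+ M)
    {ε : Matrix (Fin 2) (Fin 2) E} {z : M} (hε : ∀ x, φ (ε *ᵥ x) = z * φ x) (B : Submodule 𝒪[E] (Fin 2 → E)) :
    (B.map ((Matrix.toLin' ε).restrictScalars 𝒪[E])).toAddSubgroup.map φ = z • (B.toAddSubgroup.map φ) := by
  ext w
  simp only [AddSubgroup.mem_map, Submodule.mem_toAddSubgroup, Submodule.mem_map, LinearMap.coe_restrictScalars, Matrix.toLin'_apply,
    AddSubgroup.mem_smul_pointwise_iff_exists, smul_eq_mul]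
  constructor
  · rintro ⟨_, ⟨β, hβ, rfl⟩, rfl⟩
    exact ⟨φ β, ⟨β, hβ, rfl⟩, (hε β).symm⟩
  · rintro ⟨_, ⟨β, hβ, rfl⟩, rfl⟩
    exact ⟨ε *ᵥ β, ⟨β, hβ, rfl⟩, hε β⟩

/-- **PACKAGE**: for the line model and any `z` with `z·Θz = jE ξ` there is a matrix `ε` which is a similitude of multiplier `ξ`, commutes with `γ₂`, and transports every plane
lattice `B` to `z • φ(B)` — the three instance letters `hε`, `hεγ`, `hB′`-shape of ★ p861311 ∕ ★ p861368 at once. [cite: Jacobowitz1962, §4] [cite: Flicker1998UnitaryFL, p. 84 REMARK] -/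
theorem exists_similitude_of_lineModel [Valued E ℤᵐ⁰] (σ : E →+* E) (H₂ : Matrix (Fin 2) (Fin 2) E) (jE : E →+* M) {ρ Θ : M →+* M}
    (hjfix : ∀ w, ρ w = w ↔ ∃ c, jE c = w) (φ : (Fin 2 → E) →+ M) (hφs : ∀ (c : E) (x : Fin 2 → E), φ (c • x) = jE c * φ x)
    (hφi : Function.Injective φ) (hφo : Function.Surjective φ) {γ₂ : Matrix (Fin 2) (Fin 2) E} {lam h : M} (hφγ : ∀ x, φ (γ₂ *ᵥ x) = lam * φ x)
    (hform : ∀ x y, jE (pairing σ H₂ x y) = h * Θ (φ x) * φ y + ρ (h * Θ (φ x) * φ y))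
    {z : M} {ξ : E} (hzξ : z * Θ z = jE ξ) :
    ∃ ε : Matrix (Fin 2) (Fin 2) E, (∀ x, φ (ε *ᵥ x) = z * φ x) ∧ (∀ x y, pairing σ H₂ (ε *ᵥ x) (ε *ᵥ y) = ξ * pairing σ H₂ x y) ∧ ε * γ₂ = γ₂ * ε ∧
      ∀ B : Submodule 𝒪[E] (Fin 2 → E), (B.map ((Matrix.toLin' ε).restrictScalars 𝒪[E])).toAddSubgroup.map φ = z • (B.toAddSubgroup.map φ) := by
  obtain ⟨ε, hε⟩ := exists_matrix_mulVec_eq_mul jE φ hφs hφi hφo z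
  exact ⟨ε, hε, pairing_mulVec_mulVec_eq_mul_of_lineModel σ H₂ jE hjfix φ hform hε hzξ, mul_eq_mul_of_lineModel φ hφi hφγ hε,
    map_map_toLin'_eq_smul φ hε⟩

end Summit.HodgeConjecture.HodgeConjecture.Cruxes.H413.F0P3cDyRamLineModelSimilitude

end
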